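import Summits.BirchSwinnertonDyer.BirchSwinnertonDyer.Theorems.PrintCFramBottomClassIndexLawFiveLeLevelDictionaryBetaRankZero
import Summits.BirchSwinnertonDyer.BirchSwinnertonDyer.Theorems.PrintCFramBottomClassIndexLawFiveLeLevelDictionaryPadic
import HarnessLib

/-!
# Route `PrintCFram`, crux C2 `BottomClassIndexLawFiveLe` (stmt-BirchSwinnertonDyer-20372), line
# `eisenstein-resource-bdp-line` (registry v18/v19; LEAD g10 report §2(d)(β), §4 `classFactor_imp_levelPos_or_sha`):
# **THE LEVEL DICTIONARY (β) IN THE CRUX'S OWN CURRENCY** — «some non-`p`-divisible rational point is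
# `p`-divisible in `W(ℚ_v)`, `v ∣ p`» (p669667) ⟹ «THE generator of `W(ℚ)` modulo torsion is `p`-divisible in
# `W(ℚ_[p])`», i.e. the crux's LEVEL binder `∃ Q : W(ℚ_[p]), p • Q = toPadicPoint p g` (`n ≥ 1`)
# (cell `bsd-print-cfram`, width seat `bsd-line-cfram-p1-w5` g3; helper `--supports` 20372; 0 defs, 0 facts,
# 0 sorry)

HONEST FRAMING. Nothing about BSD is proved here, and nothing of any stub. w4 g8's (β, Galois half)
`LevelDictionary.levelPos_or_sha_of_unramified_sub_class` (p669667) produces, in its second alternative, SOME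
point `P' ∈ W(K)` not `p`-divisible in `W(K)` but `p`-divisible in `W(K_v)` at every `v ∣ p`, in the
`adicCompletion` currency. The crux (`X12.O11.RamifiedCMBottomClassIndexLawAtZp`, via
`RamifiedSevenEllipticUnits.exists_generator_with_level`) speaks of THE generator `g` of `W(ℚ)` modulo torsion
(`∀ R, ∃ k T, IsOfFinAddOrder T ∧ R = k • g + T`) and of its LEVEL `n` in `W(ℚ_[p])`
(`∃ Q, p ^ n • Q = W.toPadicPoint p g`). This file is the bookkeeping between the two:

* §1 (algebra) `exists_zsmul_eq_of_isOfFinAddOrder` — in a group with no `p`-torsion every torsion element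
  is `p`-divisible (Bézout on its order); **`exists_zsmul_eq_map_of_generator`** — if `P' = k • g + T` is NOT
  `p`-divisible (so `p ∤ k`) and `f P'` is `p`-divisible, then `f g` is `p`-divisible (Bézout on `k`), for any
  additive map `f` (here `W(ℚ) → W(ℚ_[p])`).
* §2 `exists_toPadicPoint_eq_zsmul_of_baseChange` — `P = n • R` in `W(ℚ_v)` ⟹ `n • Q = toPadicPoint p P` in
  `W(ℚ_[p])` (transport along Mathlib's `adicCompletion.padicEquiv v : ℚ_v ≃ₐ[ℚ] ℚ_[p]`; converse of w4 g8's
  `exists_baseChange_eq_zsmul_of_toPadicPoint`); `exists_heightOneSpectrum_rat_natCast_mem` — the place of `ℚ`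
  above `p`.
* §3 **`sha_or_generator_levelPos_of_unramified_sub_class`** — p669667 for `K = ℚ` with its second
  alternative rewritten as the crux's level binder of ANY generator `g` modulo torsion: for `W/ℚ` with
  `W(ℚ)[p] = 0` (automatic on the class, `LevelDictionary.forall_nsmul_eq_zero_of_cmRamified`), an
  everywhere-unramified non-zero class of the sub line gives `Ш(W/ℚ)[p] ∋ c ≠ 0` OR
  `∃ Q : W(ℚ_[p]), p • Q = W.toPadicPoint p g` (LEVEL `n ≥ 1`); **`…_cmRamified`** — the class form.

THEOREMS ONLY; no definition, no named fact, no `sorry`. BSD is not proved by any of this; no summit statement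
is proved by this seat. References: [SilvermanAEC2009] VIII.§2, X.§4 (Thm. 4.2); [GreenbergLNM1716] §3;
Mathlib `Mathlib.NumberTheory.Padics.HeightOneSpectrum`; the LEAD g10 report §2(d), §4.
-/

set_option autoImplicit false
-- `…BirchSwinnertonDyer.BirchSwinnertonDyer.Theorems…` is the problem's mandated namespace (D-0017).
set_option linter.dupNamespace false

noncomputable section

open scoped Classical

namespace Summit.BirchSwinnertonDyer.BirchSwinnertonDyer.Theorems.PrintCFram.LevelDictionaryBeta

open NumberField IsDedekindDomain Field WeierstrassCurve Rat.HeightOneSpectrum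
open Literature.NumberTheory.EllipticCurves Literature.NumberTheory.GaloisRepresentations
  Literature.NumberTheory.EllipticCurves.GreenbergSelmer
open Literature.NumberTheory.EllipticCurves.Rank1Residual (CMRamified)
open Summit.BirchSwinnertonDyer.Rank1Residual
open Summit.BirchSwinnertonDyer.BirchSwinnertonDyer.Theorems.PrintCFram.LevelDictionary

/-! ## §1 Algebra: torsion is `p`-divisible without `p`-torsion; a non-`p`-divisible `k • g + T` has `p ∤ k` -/

section Algebra

variable {M N : Type*} [AddCommGroup M] [AddCommGroup N]

/-- **In a group with no `p`-torsion every torsion element is `p`-divisible**: if `T` has finite order `m`,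
then `p ∤ m` (otherwise `(m/p) • T` would be a non-zero element killed by `p`), and Bézout `a p + b m = 1` gives
`T = p • (a • T)`. [cite: SilvermanAEC2009, VIII.§2] -/
theorem exists_zsmul_eq_of_isOfFinAddOrder (p : ℕ) (hp : p.Prime) (hnt : ∀ x : M, p • x = 0 → x = 0)
    {T : M} (hT : IsOfFinAddOrder T) : ∃ S : M, (p : ℤ) • S = T := by
  set m := addOrderOf T with hm
  have hm0 : 0 < m := hT.addOrderOf_pos
  have hpm : ¬ p ∣ m := by
    rintro ⟨c, hc⟩
    have hc0 : 0 < c := Nat.pos_of_ne_zero (by rintro rfl; rw [mul_zero] at hc; omega)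
    have hcT : p • (c • T) = 0 := by rw [← mul_nsmul', ← hc, hm, addOrderOf_nsmul_eq_zero]
    have h0 : c • T = 0 := hnt _ hcT
    have hle : m ≤ c := by
      rw [hm]
      exact addOrderOf_le_of_nsmul_eq_zero hc0 h0
    have : m < m := lt_of_le_of_lt hle (by
      rw [hc]
      exact lt_mul_left hc0 hp.one_lt)
    exact lt_irrefl _ this
  have hcop : IsCoprime (p : ℤ) (m : ℤ) := by
    rw [Int.isCoprime_iff_gcd_eq_one, Int.gcd_natCast_natCast]
    exact (Nat.Prime.coprime_iff_not_dvd hp).2 hpm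
  obtain ⟨a, b, hab⟩ := hcop
  refine ⟨a • T, ?_⟩
  have hmT : (m : ℤ) • T = 0 := by rw [natCast_zsmul, hm, addOrderOf_nsmul_eq_zero]
  calc (p : ℤ) • a • T = (a * p) • T := by rw [smul_smul, mul_comm]
    _ = (a * p) • T + b • ((m : ℤ) • T) := by rw [hmT, smul_zero, add_zero]
    _ = (a * p + b * m) • T := by rw [add_smul, smul_smul]
    _ = T := by rw [hab, one_smul]

/-- **A non-`p`-divisible `P' = k • g + T` (`T` torsion) forces `p`-divisibility of `f g` from that of `f P'`.**
In a group `M` with no `p`-torsion let `g, P' ∈ M` with `P' = k • g + T`, `T` of finite order, `P'` NOT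
`p`-divisible in `M`; if `f P' = p • Q` in `N` for an additive map `f : M → N`, then `f g = p • Q'` for some `Q'`.
(`T = p • S` by `exists_zsmul_eq_of_isOfFinAddOrder`, so `p ∤ k`; Bézout `a k + b p = 1` gives
`f g = p • (a • (Q − f S) + b • f g)`.) [cite: SilvermanAEC2009, VIII.§2] -/
theorem exists_zsmul_eq_map_of_generator (f : M →+ N) (p : ℕ) (hp : p.Prime)
    (hnt : ∀ x : M, p • x = 0 → x = 0) {g P' : M} {k : ℤ} {T : M} (hT : IsOfFinAddOrder T)
    (hP'eq : P' = k • g + T) (hP' : ∀ R : M, (p : ℤ) • R ≠ P') {Q : N} (hQ : (p : ℤ) • Q = f P') :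
    ∃ Q' : N, (p : ℤ) • Q' = f g := by
  obtain ⟨S, hS⟩ := exists_zsmul_eq_of_isOfFinAddOrder p hp hnt hT
  have hpk : ¬ (p : ℤ) ∣ k := by
    rintro ⟨c, hc⟩
    apply hP' (c • g + S)
    rw [hP'eq, hc, ← hS, smul_add, smul_smul]
  have hpI : Prime (p : ℤ) := Int.prime_iff_natAbs_prime.2 (by simpa using hp)
  have hcop : IsCoprime (p : ℤ) k := hpI.irreducible.coprime_iff_not_dvd.2 hpk
  obtain ⟨b, a, hab⟩ := hcop
  refine ⟨a • (Q - f S) + b • f g, ?_⟩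
  have hk : k • f g = (p : ℤ) • (Q - f S) := by
    rw [smul_sub, hQ, hP'eq, map_add, map_zsmul, ← hS, map_zsmul, add_sub_cancel_right]
  have hcalc : (p : ℤ) • (a • (Q - f S) + b • f g) = (a * k + b * p) • f g := by
    rw [smul_add, smul_smul, smul_smul, mul_comm (p : ℤ) a, mul_comm (p : ℤ) b, ← smul_smul a, ← hk, smul_smul,
      ← add_smul]
  rw [hcalc, show a * k + b * p = 1 by linear_combination hab, one_smul]

end Algebra

/-! ## §2 `ℚ_v` versus `ℚ_[p]`; the place above `p` -/

section Padic

/-- **Points divisible at `ℚ_v` are divisible at `ℚ_[p]`** (converse of w4 g8's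
`exists_baseChange_eq_zsmul_of_toPadicPoint`): for the finite place `v` of `ℚ` with `primesEquiv v = p`,
`P ∈ W(ℚ)` and `P = n • R` in `W(ℚ_v)`, the transport `Q` of `R` along `padicEquiv v : ℚ_v ≃ₐ[ℚ] ℚ_[p]`
satisfies `n • Q = toPadicPoint p P`. [folklore] -/
theorem exists_toPadicPoint_eq_zsmul_of_baseChange (W : WeierstrassCurve ℚ) (v : HeightOneSpectrum (𝓞 ℚ))
    {p : ℕ} [Fact p.Prime] (hv : (primesEquiv v : ℕ) = p) (P : W.toAffine.Point) {n : ℤ}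
    {R : (W.baseChange (v.adicCompletion ℚ)).toAffine.Point}
    (hR : Affine.Point.baseChange (W' := W) ℚ (v.adicCompletion ℚ) P = n • R) :
    ∃ Q : (W.baseChange ℚ_[p]).toAffine.Point, n • Q = W.toPadicPoint p P := by
  subst hv
  let e : v.adicCompletion ℚ ≃ₐ[ℚ] ℚ_[(primesEquiv v : ℕ)] := (adicCompletion.padicEquiv v).toAlgEquiv
  refine ⟨Affine.Point.map (W' := W) (e : v.adicCompletion ℚ →ₐ[ℚ] ℚ_[(primesEquiv v : ℕ)]) R, ?_⟩
  rw [← map_zsmul, ← hR]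
  exact Affine.Point.map_baseChange (W' := W) (F := ℚ) (e : v.adicCompletion ℚ →ₐ[ℚ] ℚ_[(primesEquiv v : ℕ)]) P

/-- The place of `ℚ` above a rational prime `p`. [folklore] -/
theorem exists_heightOneSpectrum_rat_natCast_mem {p : ℕ} (hp : p.Prime) :
    ∃ v : HeightOneSpectrum (𝓞 ℚ), ((p : ℕ) : 𝓞 ℚ) ∈ v.asIdeal := by
  have hp0 : Ideal.span {(p : ℤ)} ≠ ⊥ := by
    rw [Ne, Ideal.span_singleton_eq_bot]; exact_mod_cast hp.ne_zero
  haveI : (Ideal.span {(p : ℤ)}).IsMaximal :=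
    ((Ideal.span_singleton_prime (by exact_mod_cast hp.ne_zero)).mpr
      (Nat.prime_iff_prime_int.mp hp)).isMaximal hp0
  obtain ⟨Q, hQmax, hQover⟩ :=
    Ideal.exists_maximal_ideal_liesOver_of_isIntegral (S := 𝓞 ℚ) (Ideal.span {(p : ℤ)})
  have hQ0 : Q ≠ ⊥ := Ideal.ne_bot_of_liesOver_of_ne_bot hp0 Q
  refine ⟨⟨Q, hQmax.isPrime, hQ0⟩, ?_⟩
  have h : algebraMap ℤ (𝓞 ℚ) (p : ℤ) ∈ Q := by
    rw [← Ideal.mem_comap, ← Ideal.under_def, ← hQover.over]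
    exact Ideal.mem_span_singleton_self _
  rwa [map_natCast] at h

end Padic

/-! ## §3 (β) in the crux's currency: `Ш[p] ≠ 0` or the generator has LEVEL ≥ 1 -/

section Crux

variable (W : WeierstrassCurve ℚ) [W.IsElliptic]

/-- **(β) IN THE CRUX'S CURRENCY.** `W/ℚ` elliptic with `W(ℚ)[p] = 0` (`p` odd), `g ∈ W(ℚ)` a generator
modulo torsion (`∀ R, ∃ k T, IsOfFinAddOrder T ∧ R = k • g + T` — the binder of
`RamifiedSevenEllipticUnits.exists_generator_with_level`); `Φ ≤ W[p]` a `Γ_ℚ`-stable line with `Φ.Quot^{Γ_ℚ} = 0`,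
`Φ.Sub` with no vector fixed by the inertia group at `p`, `W(ℚ_ℓ)[p] = 0` at the bad `ℓ ≠ p`; `w : Γ_ℚ → Φ.Sub` a
continuous crossed homomorphism with NON-ZERO class, a coboundary on every inertia group. THEN EITHER
`Ш(W/ℚ) ∋ c ≠ 0` with `p • c = 0`, OR the crux's LEVEL binder holds: `∃ Q : W(ℚ_[p]), p • Q = toPadicPoint p g`
(`n ≥ 1`). PROOF: p669667 gives `Ш` or a non-`p`-divisible `P'` with `P' ∈ p W(ℚ_v)` (`v ∣ p`); transport to
`ℚ_[p]` (§2) and pass from `P' = k • g + T` to `g` (§1). [cite: SilvermanAEC2009, Thm. X.4.2(a) and VIII.§2]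
[cite: GreenbergLNM1716, §3 (PDF p. 86)] -/
theorem sha_or_generator_levelPos_of_unramified_sub_class (p : ℕ) [hp : Fact p.Prime] (hp2 : p ≠ 2)
    (hnt : ∀ P : W.toAffine.Point, p • P = 0 → P = 0)
    {g : W.toAffine.Point}
    (hgen : ∀ R : W.toAffine.Point, ∃ (k : ℤ) (T : W.toAffine.Point), IsOfFinAddOrder T ∧ R = k • g + T)
    (Φ : X2.ResidualDevissageModules.StableSubgroup (absoluteGaloisGroup ℚ) (geomTorsion W (p : ℤ)))
    (hQΓ : ∀ q : Φ.Quot, (∀ γ : absoluteGaloisGroup ℚ, γ • q = q) → q = 0)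
    (hSp : ∀ v : HeightOneSpectrum (𝓞 ℚ), ((p : ℕ) : 𝓞 ℚ) ∈ v.asIdeal →
      ∀ s : Φ.Sub, (∀ γ ∈ (adicCompletionPrime ℚ v).inertia (absoluteGaloisGroup ℚ), γ • s = s) → s = 0)
    (hbad : ∀ v : HeightOneSpectrum (𝓞 ℚ), ¬ W.HasGoodReductionAt v → ((p : ℕ) : 𝓞 ℚ) ∉ v.asIdeal →
      ∀ P : (W.baseChange (v.adicCompletion ℚ)).toAffine.Point, p • P = 0 → P = 0)
    (w : contOneCocycles (discreteTopRep (absoluteGaloisGroup ℚ) Φ.Sub)) (hw : oneCocycleClass _ w ≠ 0)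
    (hwI : ∀ (v : HeightOneSpectrum (𝓞 ℚ)) (𝔓 : Ideal (absIntegers (𝓞 ℚ) ℚ)), 𝔓 ∈ v.primesAbove →
      ∃ s : Φ.Sub, ∀ γ ∈ 𝔓.inertia (absoluteGaloisGroup ℚ), w.1 γ = γ • s - s) :
    (∃ c ∈ W.sha, c ≠ 0 ∧ p • c = 0) ∨
      ∃ Q : (W.baseChange ℚ_[p]).toAffine.Point, p • Q = W.toPadicPoint p g := by
  rcases levelPos_or_sha_of_unramified_sub_class W p hp2 Φ hQΓ hSp hbad w hw hwI with h | ⟨P', hP', hloc⟩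
  · exact Or.inl h
  · right
    obtain ⟨v, hv⟩ := exists_heightOneSpectrum_rat_natCast_mem hp.out
    obtain ⟨R, hR⟩ := hloc v hv
    obtain ⟨Q, hQ⟩ := exists_toPadicPoint_eq_zsmul_of_baseChange W v
      (Rat.HeightOneSpectrum.primesEquiv_eq_of_natCast_mem v hp.out hv) P' hR
    obtain ⟨k, T, hT, hP'eq⟩ := hgen P'
    -- (the generic lemma sees `W.toAffine.Point` with the classical `DecidableEq`; bridge by `convert`)
    have hnt' : ∀ x : W.toAffine.Point, p • x = 0 → x = 0 := fun x hx => hnt x (by convert hx)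
    obtain ⟨Q', hQ'⟩ := exists_zsmul_eq_map_of_generator (W.toPadicPoint p) p hp.out hnt' hT
      (by convert hP'eq) (fun R hR' => hP' R (by convert hR')) hQ
    exact ⟨Q', by rw [← natCast_zsmul]; exact hQ'⟩

variable [W.IsGloballyMinimal]

/-- **(β) IN THE CRUX'S CURRENCY, ON THE CLASS.** `W/ℚ` globally minimal with CM, `p ≥ 5` CM-RAMIFIED (so
`W(ℚ)[p] = 0`), `g` a generator of `W(ℚ)` modulo torsion, `Φ`, `w` as in
`sha_or_generator_levelPos_of_unramified_sub_class`: `Ш(W/ℚ)[p] ∋ c ≠ 0` OR `∃ Q : W(ℚ_[p]), p • Q = toPadicPoint p g`.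
[cite: SilvermanAEC2009, Thm. X.4.2(a)] [cite: GreenbergLNM1716, §3 Thm. 1.2, §4 Lemma 4.2] -/
theorem sha_or_generator_levelPos_of_unramified_sub_class_cmRamified (p : ℕ) [hp : Fact p.Prime]
    (hCM : W.HasCM) (h5 : 5 ≤ p) (hram : CMRamified W p)
    {g : W.toAffine.Point}
    (hgen : ∀ R : W.toAffine.Point, ∃ (k : ℤ) (T : W.toAffine.Point), IsOfFinAddOrder T ∧ R = k • g + T)
    (Φ : X2.ResidualDevissageModules.StableSubgroup (absoluteGaloisGroup ℚ) (geomTorsion W (p : ℤ)))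
    (hQΓ : ∀ q : Φ.Quot, (∀ γ : absoluteGaloisGroup ℚ, γ • q = q) → q = 0)
    (hSp : ∀ v : HeightOneSpectrum (𝓞 ℚ), ((p : ℕ) : 𝓞 ℚ) ∈ v.asIdeal →
      ∀ s : Φ.Sub, (∀ γ ∈ (adicCompletionPrime ℚ v).inertia (absoluteGaloisGroup ℚ), γ • s = s) → s = 0)
    (hbad : ∀ v : HeightOneSpectrum (𝓞 ℚ), ¬ W.HasGoodReductionAt v → ((p : ℕ) : 𝓞 ℚ) ∉ v.asIdeal →
      ∀ P : (W.baseChange (v.adicCompletion ℚ)).toAffine.Point, p • P = 0 → P = 0)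
    (w : contOneCocycles (discreteTopRep (absoluteGaloisGroup ℚ) Φ.Sub)) (hw : oneCocycleClass _ w ≠ 0)
    (hwI : ∀ (v : HeightOneSpectrum (𝓞 ℚ)) (𝔓 : Ideal (absIntegers (𝓞 ℚ) ℚ)), 𝔓 ∈ v.primesAbove →
      ∃ s : Φ.Sub, ∀ γ ∈ 𝔓.inertia (absoluteGaloisGroup ℚ), w.1 γ = γ • s - s) :
    (∃ c ∈ W.sha, c ≠ 0 ∧ p • c = 0) ∨
      ∃ Q : (W.baseChange ℚ_[p]).toAffine.Point, p • Q = W.toPadicPoint p g := by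
  have hp2 : p ≠ 2 := by
    have := hp.out.two_le
    omega
  exact sha_or_generator_levelPos_of_unramified_sub_class W p hp2 (forall_nsmul_eq_zero_of_cmRamified W p hCM h5 hram)
    hgen Φ hQΓ hSp hbad w hw hwI

end Crux

end Summit.BirchSwinnertonDyer.BirchSwinnertonDyer.Theorems.PrintCFram.LevelDictionaryBeta

end
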